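import Literature.Barriers.QuantumFields.FiniteTemperaturePolyakovDiagonal
import HarnessLib

/-!
# Spatial reflections of the finite-temperature lattice `ℤ_{L₀} × (ℤ/L)^d` and the slice
# decomposition of the Wilson action in a spatial direction

First of three theorem-only files establishing REFLECTION POSITIVITY IN A SPATIAL DIRECTION for the
finite-temperature Wilson lattice gauge theory of
`Literature.Barriers.QuantumFields.FiniteTemperatureDeconfinement` (configurations
`FiniteTemperature.Config d L₀ L G`, weight `FiniteTemperature.weight ρ J_E J_M`), the input of the
tree's proof of Borgs–Seiler's infrared bound (Lemma III.6 of Commun. Math. Phys. 91 (1983);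
named fact `BorgsSeilerInfraredBoundExplicit`): Borgs–Seiler's transfer matrix "in the 1-direction"
(§III.2, p. 348: "We again denote by `𝒯` the transfer matrix in the 1-direction") rests on
reflection positivity "with respect to reflection both in lattice planes and in planes lying
half-way between lattice planes" (§II.2, pp. 331–332), here in a spatial direction `i`. The
companion files are `FiniteTemperatureSpatialReflectionBlocks` (halves, blocks of links,
dependence lemmas) and `FiniteTemperatureSpatialReflectionPositivity` (randomisation of the
crossing links, Gram features, the two positivity theorems). The time-direction analogue is
`FiniteTemperatureReflection` / `FiniteTemperaturePolyakovDiagonal{,Odd}`, whose pattern we follow.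

## Contents (everything proved; no named facts)

* `bondRefl i` (`x_i ↦ 1 − x_i`) and `siteRefl i` (`x_i ↦ −x_i`) on `(ℤ/L)^d`, involutions,
  `θ(x + e_i) = σ x`, commutation with transverse steps.
* `spaceReflect i` — **the bond reflection on configurations** (non-`i` links read at the reflected
  site, the direction-`i` link from `x` becomes the one from `σx` traversed backwards): involution,
  `spaceReflect_eq` (relabelling + inversion), `measurePreserving_spaceReflect`, continuity,
  Polyakov loops go to Polyakov loops (`polyakovTrace_spaceReflect`), and
  `spaceReflect_translate : θ ∘ τ_{c e_i} = τ_{−c e_i} ∘ θ`.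
* `spaceSiteReflect i := translate e_i ∘ spaceReflect i` — **the site reflection** (planes
  `x_i = 0`, `x_i = L/2`), measure preserving, continuous, `polyakovTrace_spaceSiteReflect`.
* Plaquettes under `θ`: `plaquette_spaceReflect_of_ne` (planes not containing `i` are read at
  `θy`), `plaquette_spaceReflect_none_same / _same_some / _some_same` (planes containing `i` are
  `v⁻¹ P(σy)⁻¹ v`).
* `inSlice ρ J_E J_M i j` / `crossSlice ρ J_E J_M i j` — the parts of `−S` made of the plaquettes
  based in the slice `x_i = j` whose plane does not / does contain `i`;
  `minusAction_eq_sum_dirSlices : −S = Σ_j (inSlice_j + crossSlice_j)`;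
  `inSlice_spaceReflect : inSlice_j(θU) = inSlice_{1−j}(U)`, `crossSlice_spaceReflect` (`j ↦ −j`,
  unitary `ρ`), the translated and site-reflected versions.

References: C. Borgs, E. Seiler, Commun. Math. Phys. 91 (1983) 329–380, §II.2 (pp. 331–332),
§III.2 (p. 348); J. Fröhlich, R. Israel, E. H. Lieb, B. Simon, Commun. Math. Phys. 62 (1978) 1,
Thm 2.1 (reflections through sites and through bonds). [BorgsSeiler1983] [FrohlichEtAl1978]
-/


noncomputable section

open MeasureTheory Filter Topology
open scoped ComplexConjugate ComplexOrder

namespace Literature.Barriers.QuantumFields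

namespace FiniteTemperature

variable {d L₀ L : ℕ} {G : Type*} [Group G] {N : ℕ}

/-! ### Reflections of the spatial torus in the direction `i` -/

/-- The bond reflection of the `i`-th coordinate: `x_i ↦ 1 - x_i` (reflection in the hyperplanes
`x_i = 1/2` and `x_i = (L+1)/2`). [folklore] -/
def bondRefl (i : Fin d) (x : Fin d → ZMod L) : Fin d → ZMod L := Function.update x i (1 - x i)

/-- The site reflection of the `i`-th coordinate: `x_i ↦ -x_i`. [folklore] -/
def siteRefl (i : Fin d) (x : Fin d → ZMod L) : Fin d → ZMod L := Function.update x i (-x i)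

/-- The reflected coordinate. [folklore] -/
@[simp] theorem bondRefl_apply_same (i : Fin d) (x : Fin d → ZMod L) : bondRefl i x i = 1 - x i := by
  simp [bondRefl]

/-- The other coordinates are unchanged. [folklore] -/
@[simp] theorem bondRefl_apply_of_ne {i j : Fin d} (h : j ≠ i) (x : Fin d → ZMod L) :
    bondRefl i x j = x j := by
  simp [bondRefl, h]

/-- The reflected coordinate. [folklore] -/
@[simp] theorem siteRefl_apply_same (i : Fin d) (x : Fin d → ZMod L) : siteRefl i x i = -x i := by
  simp [siteRefl]

/-- The other coordinates are unchanged. [folklore] -/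
@[simp] theorem siteRefl_apply_of_ne {i j : Fin d} (h : j ≠ i) (x : Fin d → ZMod L) :
    siteRefl i x j = x j := by
  simp [siteRefl, h]

/-- The bond reflection of sites is an involution. [folklore] -/
theorem bondRefl_bondRefl (i : Fin d) (x : Fin d → ZMod L) : bondRefl i (bondRefl i x) = x := by
  funext j
  by_cases h : j = i
  · subst h; simp
  · simp [h]

/-- The site reflection of sites is an involution. [folklore] -/
theorem siteRefl_siteRefl (i : Fin d) (x : Fin d → ZMod L) : siteRefl i (siteRefl i x) = x := by
  funext j
  by_cases h : j = i
  · subst h; simp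
  · simp [h]

/-- `θ(x + e_i) = θ x − e_i = σ x` for the bond reflection `θ` and the site reflection `σ`. [folklore] -/
theorem bondRefl_add_single (i : Fin d) (x : Fin d → ZMod L) :
    bondRefl i (x + Pi.single i 1) = siteRefl i x := by
  funext j
  by_cases h : j = i
  · subst h
    simp only [bondRefl, siteRefl, Function.update_self, Pi.add_apply, Pi.single_eq_same]
    ring
  · simp [h]

/-- `σ x + e_i = θ x`. [folklore] -/
theorem siteRefl_add_single (i : Fin d) (x : Fin d → ZMod L) :
    siteRefl i x + Pi.single i 1 = bondRefl i x := by
  funext j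
  by_cases h : j = i
  · subst h
    simp only [bondRefl, siteRefl, Function.update_self, Pi.add_apply, Pi.single_eq_same]
    ring
  · simp [h]

/-- Transverse steps commute with the reflections. [folklore] -/
theorem bondRefl_add_single_of_ne {i j : Fin d} (h : j ≠ i) (x : Fin d → ZMod L) :
    bondRefl i (x + Pi.single j 1) = bondRefl i x + Pi.single j 1 := by
  funext k
  by_cases hk : k = i
  · subst hk; simp [h.symm]
  · simp [hk]

/-- Transverse steps commute with the site reflection. [folklore] -/
theorem siteRefl_add_single_of_ne {i j : Fin d} (h : j ≠ i) (x : Fin d → ZMod L) :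
    siteRefl i (x + Pi.single j 1) = siteRefl i x + Pi.single j 1 := by
  funext k
  by_cases hk : k = i
  · subst hk; simp [h.symm]
  · simp [hk]

/-! ### The bond reflection on configurations -/

/-- **The spatial bond reflection on configurations** in the direction `i`: a link not in the
direction `i` based at `(t, x)` is read at `(t, θx)`; the direction-`i` link from `(t,x)` to
`(t, x + e_i)` becomes the direction-`i` link from `(t, θx − e_i) = (t, σx)` to `(t, θx)`, traversed
backwards. [cite: BorgsSeiler1983, §II.2 (pp. 331–332)] -/
def spaceReflect (i : Fin d) (U : Config d L₀ L G) : Config d L₀ L G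
  | ((t, x), none) => U ((t, bondRefl i x), none)
  | ((t, x), some j) => if j = i then (U ((t, siteRefl i x), some i))⁻¹ else U ((t, bondRefl i x), some j)

/-- The bond reflection on time-like links. [folklore] -/
@[simp] theorem spaceReflect_none (i : Fin d) (U : Config d L₀ L G) (t : ZMod L₀) (x : Fin d → ZMod L) :
    spaceReflect i U ((t, x), none) = U ((t, bondRefl i x), none) := rfl

/-- The bond reflection on direction-`i` links (inversion). [folklore] -/
@[simp] theorem spaceReflect_same (i : Fin d) (U : Config d L₀ L G) (t : ZMod L₀) (x : Fin d → ZMod L) :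
    spaceReflect i U ((t, x), some i) = (U ((t, siteRefl i x), some i))⁻¹ := by
  simp [spaceReflect]

/-- The bond reflection on transverse spatial links. [folklore] -/
theorem spaceReflect_some_of_ne {i j : Fin d} (h : j ≠ i) (U : Config d L₀ L G) (t : ZMod L₀)
    (x : Fin d → ZMod L) : spaceReflect i U ((t, x), some j) = U ((t, bondRefl i x), some j) := by
  simp [spaceReflect, h]

/-- The bond reflection is an involution. [folklore] -/
theorem spaceReflect_spaceReflect (i : Fin d) (U : Config d L₀ L G) :
    spaceReflect i (spaceReflect i U) = U := by
  funext e
  rcases e with ⟨⟨t, x⟩, _ | j⟩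
  · simp [bondRefl_bondRefl]
  · by_cases h : j = i
    · subst h; simp [siteRefl_siteRefl]
    · simp [spaceReflect_some_of_ne h, bondRefl_bondRefl]

/-- The relabelling of links underlying the bond reflection. [folklore] -/
def spaceReflectLink (i : Fin d) : Site d L₀ L × Dir d → Site d L₀ L × Dir d
  | ((t, x), none) => ((t, bondRefl i x), none)
  | ((t, x), some j) => if j = i then ((t, siteRefl i x), some i) else ((t, bondRefl i x), some j)

/-- The relabelling on time-like links. [folklore] -/
@[simp] theorem spaceReflectLink_none (i : Fin d) (t : ZMod L₀) (x : Fin d → ZMod L) :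
    spaceReflectLink i (((t, x), none) : Site d L₀ L × Dir d) = ((t, bondRefl i x), none) := rfl

/-- The relabelling on direction-`i` links. [folklore] -/
@[simp] theorem spaceReflectLink_same (i : Fin d) (t : ZMod L₀) (x : Fin d → ZMod L) :
    spaceReflectLink i (((t, x), some i) : Site d L₀ L × Dir d) = ((t, siteRefl i x), some i) := by
  simp [spaceReflectLink]

/-- The relabelling on transverse spatial links. [folklore] -/
theorem spaceReflectLink_some_of_ne {i j : Fin d} (h : j ≠ i) (t : ZMod L₀) (x : Fin d → ZMod L) :
    spaceReflectLink i (((t, x), some j) : Site d L₀ L × Dir d) = ((t, bondRefl i x), some j) := by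
  simp [spaceReflectLink, h]

/-- The relabelling is an involution. [folklore] -/
theorem spaceReflectLink_spaceReflectLink (i : Fin d) (e : Site d L₀ L × Dir d) :
    spaceReflectLink i (spaceReflectLink i e) = e := by
  rcases e with ⟨⟨t, x⟩, _ | j⟩
  · simp [bondRefl_bondRefl]
  · by_cases h : j = i
    · subst h; simp [siteRefl_siteRefl]
    · simp [spaceReflectLink_some_of_ne h, bondRefl_bondRefl]


/-- The relabelling of links as a permutation. [folklore] -/
def spaceReflectLinkEquiv (i : Fin d) : Equiv.Perm (Site d L₀ L × Dir d) where
  toFun := spaceReflectLink i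
  invFun := spaceReflectLink i
  left_inv := spaceReflectLink_spaceReflectLink i
  right_inv := spaceReflectLink_spaceReflectLink i

/-- Coordinatewise inversion of the direction-`i` link variables. [folklore] -/
def invDir (i : Fin d) (e : Site d L₀ L × Dir d) (g : G) : G := if e.2 = some i then g⁻¹ else g

/-- `spaceReflect` = relabelling by `spaceReflectLink` followed by inversion of the direction-`i`
coordinates. [folklore] -/
theorem spaceReflect_eq (i : Fin d) (U : Config d L₀ L G) :
    spaceReflect i U = fun e => invDir i e (U (spaceReflectLink i e)) := by
  funext e
  rcases e with ⟨⟨t, x⟩, _ | j⟩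
  · simp [invDir]
  · by_cases h : j = i
    · subst h; simp [invDir]
    · simp [invDir, h, spaceReflect_some_of_ne h, spaceReflectLink_some_of_ne h]

variable [TopologicalSpace G] [IsTopologicalGroup G] [CompactSpace G] [MeasurableSpace G]
  [BorelSpace G]

omit [TopologicalSpace G] [IsTopologicalGroup G] [CompactSpace G] [BorelSpace G] [Group G] in
/-- Relabelling by `spaceReflectLink` as a measurable equivalence. [folklore] -/
def spaceReflectRelabelEquiv (i : Fin d) : Config d L₀ L G ≃ᵐ Config d L₀ L G :=
  MeasurableEquiv.piCongrLeft (fun _ : Site d L₀ L × Dir d => G) (spaceReflectLinkEquiv i).symm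

omit [TopologicalSpace G] [IsTopologicalGroup G] [CompactSpace G] [BorelSpace G] [Group G] in
/-- The relabelling equivalence is `U ↦ U ∘ spaceReflectLink i`. [folklore] -/
theorem coe_spaceReflectRelabelEquiv (i : Fin d) :
    ⇑(spaceReflectRelabelEquiv (d := d) (L₀ := L₀) (L := L) (G := G) i) =
      fun U e => U (spaceReflectLink i e) := by
  funext U; funext e
  rw [spaceReflectRelabelEquiv, MeasurableEquiv.coe_piCongrLeft, Equiv.piCongrLeft_apply_eq_cast,
    cast_eq]
  rfl

/-- **The bond reflection preserves the a-priori measure** (a permutation of the factors, then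
inversion of the direction-`i` ones). [folklore] -/
theorem measurePreserving_spaceReflect [NeZero L₀] [NeZero L] (i : Fin d) :
    MeasurePreserving (spaceReflect (G := G) i) (haar d L₀ L G) (haar d L₀ L G) := by
  have h1 : MeasurePreserving (spaceReflectRelabelEquiv (d := d) (L₀ := L₀) (L := L) (G := G) i)
      (haar d L₀ L G) (haar d L₀ L G) :=
    measurePreserving_piCongrLeft
      (fun _ : Site d L₀ L × Dir d =>
        Literature.MathematicalPhysics.QuantumFieldTheory.haarProbability G)
      (spaceReflectLinkEquiv i).symm
  have h2 : MeasurePreserving (fun (V : Config d L₀ L G) e => invDir i e (V e))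
      (haar d L₀ L G) (haar d L₀ L G) := by
    unfold haar
    refine measurePreserving_pi _ _ fun e => ?_
    by_cases he : e.2 = some i
    · have : invDir (G := G) i e = Inv.inv := by funext g; simp [invDir, he]
      rw [this]
      exact Measure.measurePreserving_inv _
    · have : invDir (G := G) i e = id := by funext g; simp [invDir, he]
      rw [this]
      exact MeasurePreserving.id _
  have h := h2.comp h1
  have hcomp : (fun (V : Config d L₀ L G) e => invDir i e (V e)) ∘ ⇑(spaceReflectRelabelEquiv i) =
      spaceReflect i := by
    funext U
    rw [Function.comp_apply, coe_spaceReflectRelabelEquiv, spaceReflect_eq]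
  rwa [hcomp] at h

omit [CompactSpace G] [MeasurableSpace G] [BorelSpace G] in
/-- The bond reflection is continuous. [folklore] -/
theorem continuous_spaceReflect (i : Fin d) :
    Continuous (spaceReflect i : Config d L₀ L G → Config d L₀ L G) := by
  refine continuous_pi fun e => ?_
  rcases e with ⟨⟨t, x⟩, _ | j⟩
  · simp only [spaceReflect_none]; exact continuous_apply _
  · by_cases h : j = i
    · subst h; simp only [spaceReflect_same]; exact (continuous_apply _).inv
    · simp only [spaceReflect_some_of_ne h]; exact continuous_apply _

omit [TopologicalSpace G] [IsTopologicalGroup G] [CompactSpace G] [MeasurableSpace G]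
  [BorelSpace G] in
/-- Time-like holonomies of the reflected configuration are the time-like holonomies at the
reflected site (time-like links are neither moved in time nor inverted). [folklore] -/
theorem timeHolonomy_spaceReflect (i : Fin d) (U : Config d L₀ L G) (n : ℕ) (t : ZMod L₀)
    (x : Fin d → ZMod L) :
    timeHolonomy (spaceReflect i U) n (t, x) = timeHolonomy U n (t, bondRefl i x) := by
  induction n generalizing t with
  | zero => rfl
  | succ n ih => simp only [timeHolonomy, Site.shift, spaceReflect_none, ih]

omit [TopologicalSpace G] [IsTopologicalGroup G] [CompactSpace G] [MeasurableSpace G]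
  [BorelSpace G] in
/-- Polyakov loops of the reflected configuration: `P_x(θU) = P_{θx}(U)`. [folklore] -/
theorem polyakovLine_spaceReflect (i : Fin d) (U : Config d L₀ L G) (x : Fin d → ZMod L) :
    polyakovLine (spaceReflect i U) x = polyakovLine U (bondRefl i x) :=
  timeHolonomy_spaceReflect i U L₀ 0 x

omit [TopologicalSpace G] [IsTopologicalGroup G] [CompactSpace G] [MeasurableSpace G]
  [BorelSpace G] in
variable (ρ : G →* Matrix (Fin N) (Fin N) ℂ) in
/-- Traced Polyakov loops of the reflected configuration. [folklore] -/
theorem polyakovTrace_spaceReflect (i : Fin d) (U : Config d L₀ L G) (x : Fin d → ZMod L) :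
    polyakovTrace ρ (spaceReflect i U) x = polyakovTrace ρ U (bondRefl i x) := by
  unfold polyakovTrace; rw [polyakovLine_spaceReflect]

omit [TopologicalSpace G] [IsTopologicalGroup G] [CompactSpace G] [MeasurableSpace G]
  [BorelSpace G] in
/-- **Reflections and translations**: reflecting a translated configuration is translating the
reflected configuration backwards, `θ (τ_{a} U) = τ_{-a} (θ U)` for `a = c e_i`. [folklore] -/
theorem spaceReflect_translate (i : Fin d) (c : ZMod L) (U : Config d L₀ L G) :
    spaceReflect i (translate (Pi.single i c) U) = translate (Pi.single i (-c)) (spaceReflect i U) := by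
  funext e
  have hb : ∀ x : Fin d → ZMod L, bondRefl i x + Pi.single i c = bondRefl i (x + Pi.single i (-c)) := by
    intro x; funext j
    by_cases h : j = i
    · subst h; simp; ring
    · simp [h]
  have hs : ∀ x : Fin d → ZMod L, siteRefl i x + Pi.single i c = siteRefl i (x + Pi.single i (-c)) := by
    intro x; funext j
    by_cases h : j = i
    · subst h; simp; ring
    · simp [h]
  rcases e with ⟨⟨t, x⟩, _ | j⟩
  · simp [hb]
  · by_cases h : j = i
    · subst h; simp [hs]
    · simp [spaceReflect_some_of_ne h, hb]

/-! ### The site reflection -/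

/-- **The spatial site reflection** in the direction `i` (reflection in the lattice hyperplanes
`x_i = 0` and `x_i = L/2`): `σ = τ_{e_i} ∘ θ`, i.e. non-`i` links based at `(t,x)` are read at
`(t, −x)` and the direction-`i` link from `(t,x)` is the one from `(t, −x − e_i)` backwards. [cite: BorgsSeiler1983, §II.2 (pp. 331–332)] -/
def spaceSiteReflect (i : Fin d) (U : Config d L₀ L G) : Config d L₀ L G :=
  translate (Pi.single i 1) (spaceReflect i U)

omit [TopologicalSpace G] [IsTopologicalGroup G] [CompactSpace G] [MeasurableSpace G]
  [BorelSpace G] in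
/-- The site reflection on time-like links. [folklore] -/
@[simp] theorem spaceSiteReflect_none (i : Fin d) (U : Config d L₀ L G) (t : ZMod L₀)
    (x : Fin d → ZMod L) : spaceSiteReflect i U ((t, x), none) = U ((t, siteRefl i x), none) := by
  simp [spaceSiteReflect, bondRefl_add_single]

omit [TopologicalSpace G] [IsTopologicalGroup G] [CompactSpace G] [MeasurableSpace G]
  [BorelSpace G] in
/-- The site reflection on transverse spatial links. [folklore] -/
theorem spaceSiteReflect_some_of_ne {i j : Fin d} (h : j ≠ i) (U : Config d L₀ L G) (t : ZMod L₀)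
    (x : Fin d → ZMod L) : spaceSiteReflect i U ((t, x), some j) = U ((t, siteRefl i x), some j) := by
  simp [spaceSiteReflect, spaceReflect_some_of_ne h, bondRefl_add_single]

omit [TopologicalSpace G] [IsTopologicalGroup G] [CompactSpace G] [MeasurableSpace G]
  [BorelSpace G] in
/-- The site reflection on direction-`i` links (the link from `σx − e_i`, inverted). [folklore] -/
@[simp] theorem spaceSiteReflect_same (i : Fin d) (U : Config d L₀ L G) (t : ZMod L₀)
    (x : Fin d → ZMod L) :
    spaceSiteReflect i U ((t, x), some i) = (U ((t, siteRefl i x - Pi.single i 1), some i))⁻¹ := by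
  simp only [spaceSiteReflect, translate_apply, spaceReflect_same]
  have : siteRefl i (x + Pi.single i 1) = siteRefl i x - Pi.single i 1 := by
    funext j
    by_cases h : j = i
    · subst h; simp; ring
    · simp [h]
  rw [this]

/-- The site reflection preserves the a-priori measure. [folklore] -/
theorem measurePreserving_spaceSiteReflect [NeZero L₀] [NeZero L] (i : Fin d) :
    MeasurePreserving (spaceSiteReflect (G := G) i) (haar d L₀ L G) (haar d L₀ L G) := by
  have h := (measurePreserving_translateEquiv (d := d) (L₀ := L₀) (L := L) (G := G)
    (Pi.single i 1)).comp (measurePreserving_spaceReflect i)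
  rwa [coe_translateEquiv] at h

omit [CompactSpace G] [MeasurableSpace G] [BorelSpace G] in
/-- The site reflection is continuous. [folklore] -/
theorem continuous_spaceSiteReflect (i : Fin d) :
    Continuous (spaceSiteReflect i : Config d L₀ L G → Config d L₀ L G) := by
  unfold spaceSiteReflect translate
  exact continuous_pi fun e => (continuous_apply _).comp (continuous_spaceReflect i)

omit [TopologicalSpace G] [IsTopologicalGroup G] [CompactSpace G] [MeasurableSpace G]
  [BorelSpace G] in
variable (ρ : G →* Matrix (Fin N) (Fin N) ℂ) in
/-- Traced Polyakov loops under the site reflection: `χ(P_x(σU)) = χ(P_{σx}(U))`. [folklore] -/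
theorem polyakovTrace_spaceSiteReflect (i : Fin d) (U : Config d L₀ L G) (x : Fin d → ZMod L) :
    polyakovTrace ρ (spaceSiteReflect i U) x = polyakovTrace ρ U (siteRefl i x) := by
  rw [spaceSiteReflect, polyakovTrace_translate, polyakovTrace_spaceReflect, bondRefl_add_single]

section Plaquettes

variable {d L₀ L : ℕ} {G : Type*} [Group G] {N : ℕ}

/-! ### Plaquettes under the bond reflection -/

/-- Shifts in directions other than `i` commute with the bond reflection of the sites. [folklore] -/
theorem bondRefl_shift_of_ne (i : Fin d) {μ : Dir d} (hμ : μ ≠ some i) (y : Site d L₀ L) :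
    ((y.shift μ).1, bondRefl i (y.shift μ).2) = (Site.shift (y.1, bondRefl i y.2) μ) := by
  rcases μ with _ | k
  · rfl
  · have hk : k ≠ i := fun h => hμ (by rw [h])
    simp [Site.shift, bondRefl_add_single_of_ne hk]

/-- A link not in the direction `i` of the reflected configuration. [folklore] -/
theorem spaceReflect_apply_of_ne (i : Fin d) (U : Config d L₀ L G) (y : Site d L₀ L) {μ : Dir d}
    (hμ : μ ≠ some i) : spaceReflect i U (y, μ) = U ((y.1, bondRefl i y.2), μ) := by
  rcases y with ⟨t, x⟩
  rcases μ with _ | k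
  · rfl
  · have hk : k ≠ i := fun h => hμ (by rw [h])
    exact spaceReflect_some_of_ne hk U t x

/-- **Plaquettes not involving the direction `i`** are read at the reflected site:
`(θU)_P(y; μ, ν) = U_P(θy; μ, ν)`. [folklore] -/
theorem plaquette_spaceReflect_of_ne (i : Fin d) (U : Config d L₀ L G) (y : Site d L₀ L)
    {μ ν : Dir d} (hμ : μ ≠ some i) (hν : ν ≠ some i) :
    plaquette (spaceReflect i U) y μ ν = plaquette U (y.1, bondRefl i y.2) μ ν := by
  unfold plaquette
  rw [spaceReflect_apply_of_ne i U y hμ, spaceReflect_apply_of_ne i U _ hν,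
    spaceReflect_apply_of_ne i U _ hμ, spaceReflect_apply_of_ne i U y hν,
    bondRefl_shift_of_ne i hμ, bondRefl_shift_of_ne i hν]

/-- **The electric plaquette across the bond**: the `(time, i)` plaquette of `θU` at `(t, x)` is
`v⁻¹ P⁻¹ v` with `P` the `(time, i)` plaquette of `U` at `(t, σx)` and `v = U((t,σx), i)`. [folklore] -/
theorem plaquette_spaceReflect_none_same (i : Fin d) (U : Config d L₀ L G) (t : ZMod L₀)
    (x : Fin d → ZMod L) :
    plaquette (spaceReflect i U) (t, x) none (some i) =
      (U ((t, siteRefl i x), some i))⁻¹ * (plaquette U (t, siteRefl i x) none (some i))⁻¹ *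
        U ((t, siteRefl i x), some i) := by
  simp only [plaquette, Site.shift, spaceReflect_none, spaceReflect_same, bondRefl_add_single,
    siteRefl_add_single, mul_inv_rev, inv_inv, mul_assoc, inv_mul_cancel_left]

/-- **Magnetic plaquettes across the bond, `(i, k)`**: `(θU)_P((t,x); i, k) = v⁻¹ P⁻¹ v` with `P` the
`(i, k)` plaquette of `U` at `(t, σx)`. [folklore] -/
theorem plaquette_spaceReflect_same_some (i : Fin d) {k : Fin d} (hk : k ≠ i) (U : Config d L₀ L G)
    (t : ZMod L₀) (x : Fin d → ZMod L) :
    plaquette (spaceReflect i U) (t, x) (some i) (some k) =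
      (U ((t, siteRefl i x), some i))⁻¹ * (plaquette U (t, siteRefl i x) (some i) (some k))⁻¹ *
        U ((t, siteRefl i x), some i) := by
  simp only [plaquette, Site.shift, spaceReflect_same, spaceReflect_some_of_ne hk,
    bondRefl_add_single, siteRefl_add_single, siteRefl_add_single_of_ne hk, mul_inv_rev, inv_inv,
    mul_assoc, inv_mul_cancel, mul_one]

/-- **Magnetic plaquettes across the bond, `(k, i)`**. [folklore] -/
theorem plaquette_spaceReflect_some_same (i : Fin d) {k : Fin d} (hk : k ≠ i) (U : Config d L₀ L G)
    (t : ZMod L₀) (x : Fin d → ZMod L) :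
    plaquette (spaceReflect i U) (t, x) (some k) (some i) =
      (U ((t, siteRefl i x), some i))⁻¹ * (plaquette U (t, siteRefl i x) (some k) (some i))⁻¹ *
        U ((t, siteRefl i x), some i) := by
  simp only [plaquette, Site.shift, spaceReflect_same, spaceReflect_some_of_ne hk,
    bondRefl_add_single, siteRefl_add_single, siteRefl_add_single_of_ne hk, mul_inv_rev,
    inv_inv, mul_assoc, inv_mul_cancel_left]

end Plaquettes

section Slices

variable {d L₀ L : ℕ} {G : Type*} [Group G] {N : ℕ}
variable (ρ : G →* Matrix (Fin N) (Fin N) ℂ)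

/-- The bond reflection of sites, `(t, x) ↦ (t, θx)`, as an involutive permutation. [folklore] -/
def siteBondReflEquiv (i : Fin d) : Equiv.Perm (Site d L₀ L) where
  toFun y := (y.1, bondRefl i y.2)
  invFun y := (y.1, bondRefl i y.2)
  left_inv y := by simp [bondRefl_bondRefl]
  right_inv y := by simp [bondRefl_bondRefl]

/-- The site reflection of sites, `(t, x) ↦ (t, σx)`, as an involutive permutation. [folklore] -/
def siteSiteReflEquiv (i : Fin d) : Equiv.Perm (Site d L₀ L) where
  toFun y := (y.1, siteRefl i y.2)
  invFun y := (y.1, siteRefl i y.2)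
  left_inv y := by simp [siteRefl_siteRefl]
  right_inv y := by simp [siteRefl_siteRefl]

/-- Pointwise form. [folklore] -/
@[simp] theorem siteBondReflEquiv_apply (i : Fin d) (y : Site d L₀ L) :
    siteBondReflEquiv i y = (y.1, bondRefl i y.2) := rfl

/-- Pointwise form. [folklore] -/
@[simp] theorem siteSiteReflEquiv_apply (i : Fin d) (y : Site d L₀ L) :
    siteSiteReflEquiv i y = (y.1, siteRefl i y.2) := rfl

/-- **The in-slice part of the action at the slice `x_i = j`**: the plaquettes based at sites of the
slice whose plane does not contain the direction `i` (they lie in the hyperplane `x_i = j`). [folklore] -/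
def inSlice [NeZero L₀] [NeZero L] (JE JM : ℝ) (i : Fin d) (j : ZMod L) (U : Config d L₀ L G) : ℝ :=
  ∑ y : Site d L₀ L, if y.2 i = j then
    (JE * ∑ k ∈ Finset.univ.filter (fun k : Fin d => k ≠ i), (ρ (plaquette U y none (some k))).trace.re +
      JM * ∑ p ∈ Finset.univ.filter (fun p : {p : Fin d × Fin d // p.1 < p.2} => p.1.1 ≠ i ∧ p.1.2 ≠ i),
        (ρ (plaquette U y (some p.1.1) (some p.1.2))).trace.re)
    else 0

/-- **The cross-slice part of the action between the slices `x_i = j` and `x_i = j + 1`**: the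
plaquettes based at sites of the slice `j` whose plane contains the direction `i` (electric
`(time, i)` and magnetic `{i, k}`, in the orientation of `minusAction`). [folklore] -/
def crossSlice [NeZero L₀] [NeZero L] (JE JM : ℝ) (i : Fin d) (j : ZMod L) (U : Config d L₀ L G) : ℝ :=
  ∑ y : Site d L₀ L, if y.2 i = j then
    (JE * (ρ (plaquette U y none (some i))).trace.re +
      JM * ∑ p ∈ Finset.univ.filter (fun p : {p : Fin d × Fin d // p.1 < p.2} => ¬(p.1.1 ≠ i ∧ p.1.2 ≠ i)),
        (ρ (plaquette U y (some p.1.1) (some p.1.2))).trace.re)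
    else 0

omit ρ in
/-- Reversing the orientation of a plaquette inverts its holonomy. [folklore] -/
theorem plaquette_swap (U : Config d L₀ L G) (y : Site d L₀ L) (μ ν : Dir d) :
    plaquette U y ν μ = (plaquette U y μ ν)⁻¹ := by
  simp [plaquette, mul_assoc]

/-- **The in-slice sums under the bond reflection**: `inSlice j (θU) = inSlice (1 − j) U`. [folklore] -/
theorem inSlice_spaceReflect [NeZero L₀] [NeZero L] (JE JM : ℝ) (i : Fin d) (j : ZMod L)
    (U : Config d L₀ L G) :
    inSlice ρ JE JM i j (spaceReflect i U) = inSlice ρ JE JM i (1 - j) U := by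
  unfold inSlice
  rw [← Equiv.sum_comp (siteBondReflEquiv (L₀ := L₀) i)]
  refine Finset.sum_congr rfl fun y _ => ?_
  simp only [siteBondReflEquiv_apply, bondRefl_apply_same]
  have hj : (1 - y.2 i = j) ↔ (y.2 i = 1 - j) := by
    constructor
    · intro h; rw [← h]; ring
    · intro h; rw [h]; ring
  have hyy : ((y.1, bondRefl i y.2).1, bondRefl i (y.1, bondRefl i y.2).2) = y := by
    simp [bondRefl_bondRefl]
  by_cases hy : y.2 i = 1 - j
  · rw [if_pos hy, if_pos (hj.2 hy)]
    congr 2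
    · refine Finset.sum_congr rfl fun k hk => ?_
      have hk' : k ≠ i := (Finset.mem_filter.1 hk).2
      rw [plaquette_spaceReflect_of_ne i U _ (by simp) (by simpa using hk'), hyy]
    · refine Finset.sum_congr rfl fun p hp => ?_
      have hp' := (Finset.mem_filter.1 hp).2
      rw [plaquette_spaceReflect_of_ne i U _ (by simpa using hp'.1) (by simpa using hp'.2), hyy]
  · rw [if_neg hy, if_neg (fun h => hy (hj.1 h))]

/-- **The cross-slice sums under the bond reflection** (unitary `ρ`): `crossSlice j (θU) = crossSlice (−j) U`.
[folklore] -/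
theorem crossSlice_spaceReflect [NeZero L₀] [NeZero L] (hρu : ∀ g, ρ g ∈ Matrix.unitaryGroup (Fin N) ℂ)
    (JE JM : ℝ) (i : Fin d) (j : ZMod L) (U : Config d L₀ L G) :
    crossSlice ρ JE JM i j (spaceReflect i U) = crossSlice ρ JE JM i (-j) U := by
  unfold crossSlice
  rw [← Equiv.sum_comp (siteSiteReflEquiv (L₀ := L₀) i)]
  refine Finset.sum_congr rfl fun y _ => ?_
  simp only [siteSiteReflEquiv_apply, siteRefl_apply_same]
  have hj : (-y.2 i = j) ↔ (y.2 i = -j) := by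
    constructor
    · intro h; rw [← h, neg_neg]
    · intro h; rw [h, neg_neg]
  by_cases hy : y.2 i = -j
  · rw [if_pos hy, if_pos (hj.2 hy)]
    rcases y with ⟨t, x⟩
    congr 2
    · rw [plaquette_spaceReflect_none_same]
      simp only [siteRefl_siteRefl]
      rw [trace_re_rep_conj, trace_re_rep_inv ρ hρu]
    · refine Finset.sum_congr rfl fun p hp => ?_
      have hp' := (Finset.mem_filter.1 hp).2
      by_cases h1 : p.1.1 = i
      · have h2 : p.1.2 ≠ i := by
          intro h2; have := p.2; rw [h1, h2] at this; exact lt_irrefl _ this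
        simp only [h1]
        rw [plaquette_spaceReflect_same_some i h2]
        simp only [siteRefl_siteRefl]
        rw [trace_re_rep_conj, trace_re_rep_inv ρ hρu]
      · have h2 : p.1.2 = i := by
          by_contra h2; exact hp' ⟨h1, h2⟩
        simp only [h2]
        rw [plaquette_spaceReflect_some_same i h1]
        simp only [siteRefl_siteRefl]
        rw [trace_re_rep_conj, trace_re_rep_inv ρ hρu]
  · rw [if_neg hy, if_neg (fun h => hy (hj.1 h))]

end Slices

section ActionSplit

variable {d L₀ L : ℕ} {G : Type*} [Group G] {N : ℕ}
variable (ρ : G →* Matrix (Fin N) (Fin N) ℂ)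

/-- **The action as a sum over the slices in the direction `i`**:
`−S = Σ_j (inSlice_j + crossSlice_j)`. [folklore] -/
theorem minusAction_eq_sum_dirSlices [NeZero L₀] [NeZero L] (JE JM : ℝ) (i : Fin d) (U : Config d L₀ L G) :
    minusAction ρ JE JM U = ∑ j : ZMod L, (inSlice ρ JE JM i j U + crossSlice ρ JE JM i j U) := by
  have hin : ∑ j : ZMod L, inSlice ρ JE JM i j U = ∑ y : Site d L₀ L,
      (JE * ∑ k ∈ Finset.univ.filter (fun k : Fin d => k ≠ i), (ρ (plaquette U y none (some k))).trace.re +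
        JM * ∑ p ∈ Finset.univ.filter (fun p : {p : Fin d × Fin d // p.1 < p.2} => p.1.1 ≠ i ∧ p.1.2 ≠ i),
          (ρ (plaquette U y (some p.1.1) (some p.1.2))).trace.re) := by
    unfold inSlice
    rw [Finset.sum_comm]
    refine Finset.sum_congr rfl fun y _ => ?_
    rw [Finset.sum_ite_eq Finset.univ (y.2 i), if_pos (Finset.mem_univ _)]
  have hcross : ∑ j : ZMod L, crossSlice ρ JE JM i j U = ∑ y : Site d L₀ L,
      (JE * (ρ (plaquette U y none (some i))).trace.re +
        JM * ∑ p ∈ Finset.univ.filter (fun p : {p : Fin d × Fin d // p.1 < p.2} => ¬(p.1.1 ≠ i ∧ p.1.2 ≠ i)),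
          (ρ (plaquette U y (some p.1.1) (some p.1.2))).trace.re) := by
    unfold crossSlice
    rw [Finset.sum_comm]
    refine Finset.sum_congr rfl fun y _ => ?_
    rw [Finset.sum_ite_eq Finset.univ (y.2 i), if_pos (Finset.mem_univ _)]
  rw [Finset.sum_add_distrib, hin, hcross, ← Finset.sum_add_distrib]
  unfold minusAction
  rw [Finset.mul_sum, Finset.mul_sum, ← Finset.sum_add_distrib]
  refine Finset.sum_congr rfl fun y _ => ?_
  have he : ∑ k : Fin d, (ρ (plaquette U y none (some k))).trace.re =
      ∑ k ∈ Finset.univ.filter (fun k : Fin d => k ≠ i), (ρ (plaquette U y none (some k))).trace.re +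
        (ρ (plaquette U y none (some i))).trace.re := by
    rw [← Finset.sum_filter_add_sum_filter_not Finset.univ (fun k : Fin d => k ≠ i)]
    congr 1
    have : Finset.univ.filter (fun k : Fin d => ¬ k ≠ i) = {i} := by
      ext k; simp
    rw [this, Finset.sum_singleton]
  have hm : ∑ p : {p : Fin d × Fin d // p.1 < p.2}, (ρ (plaquette U y (some p.1.1) (some p.1.2))).trace.re =
      ∑ p ∈ Finset.univ.filter (fun p : {p : Fin d × Fin d // p.1 < p.2} => p.1.1 ≠ i ∧ p.1.2 ≠ i),
          (ρ (plaquette U y (some p.1.1) (some p.1.2))).trace.re +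
        ∑ p ∈ Finset.univ.filter (fun p : {p : Fin d × Fin d // p.1 < p.2} => ¬(p.1.1 ≠ i ∧ p.1.2 ≠ i)),
          (ρ (plaquette U y (some p.1.1) (some p.1.2))).trace.re :=
    (Finset.sum_filter_add_sum_filter_not Finset.univ _ _).symm
  rw [he, hm]
  ring

end ActionSplit

section Translate

variable {d L₀ L : ℕ} {G : Type*} [Group G] {N : ℕ}
variable (ρ : G →* Matrix (Fin N) (Fin N) ℂ)

/-- In-slice sums of a translated configuration: `inSlice j (τ_a U) = inSlice (j + a_i) U`. [folklore] -/
theorem inSlice_translate [NeZero L₀] [NeZero L] (JE JM : ℝ) (i : Fin d) (j : ZMod L)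
    (a : Fin d → ZMod L) (U : Config d L₀ L G) :
    inSlice ρ JE JM i j (translate a U) = inSlice ρ JE JM i (j + a i) U := by
  unfold inSlice
  simp_rw [plaquette_translate]
  conv_rhs => rw [← Equiv.sum_comp (siteShift (L₀ := L₀) a)]
  refine Finset.sum_congr rfl fun y _ => ?_
  have h : ((siteShift a y).2 i = j + a i) ↔ (y.2 i = j) := by
    simp only [siteShift_apply, Pi.add_apply]
    constructor
    · intro h; exact add_right_cancel h
    · intro h; rw [h]
  by_cases hy : y.2 i = j
  · rw [if_pos hy, if_pos (h.2 hy)]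
  · rw [if_neg hy, if_neg (fun h' => hy (h.1 h'))]

/-- Cross-slice sums of a translated configuration. [folklore] -/
theorem crossSlice_translate [NeZero L₀] [NeZero L] (JE JM : ℝ) (i : Fin d) (j : ZMod L)
    (a : Fin d → ZMod L) (U : Config d L₀ L G) :
    crossSlice ρ JE JM i j (translate a U) = crossSlice ρ JE JM i (j + a i) U := by
  unfold crossSlice
  simp_rw [plaquette_translate]
  conv_rhs => rw [← Equiv.sum_comp (siteShift (L₀ := L₀) a)]
  refine Finset.sum_congr rfl fun y _ => ?_
  have h : ((siteShift a y).2 i = j + a i) ↔ (y.2 i = j) := by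
    simp only [siteShift_apply, Pi.add_apply]
    constructor
    · intro h; exact add_right_cancel h
    · intro h; rw [h]
  by_cases hy : y.2 i = j
  · rw [if_pos hy, if_pos (h.2 hy)]
  · rw [if_neg hy, if_neg (fun h' => hy (h.1 h'))]

/-- In-slice sums under the site reflection: `inSlice j (σU) = inSlice (−j) U`. [folklore] -/
theorem inSlice_spaceSiteReflect [NeZero L₀] [NeZero L] (JE JM : ℝ) (i : Fin d) (j : ZMod L)
    (U : Config d L₀ L G) :
    inSlice ρ JE JM i j (spaceSiteReflect i U) = inSlice ρ JE JM i (-j) U := by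
  rw [spaceSiteReflect, inSlice_translate, inSlice_spaceReflect]
  congr 1
  simp

/-- Cross-slice sums under the site reflection (unitary `ρ`): `crossSlice j (σU) = crossSlice (−1−j) U`.
[folklore] -/
theorem crossSlice_spaceSiteReflect [NeZero L₀] [NeZero L]
    (hρu : ∀ g, ρ g ∈ Matrix.unitaryGroup (Fin N) ℂ) (JE JM : ℝ) (i : Fin d) (j : ZMod L)
    (U : Config d L₀ L G) :
    crossSlice ρ JE JM i j (spaceSiteReflect i U) = crossSlice ρ JE JM i (-1 - j) U := by
  rw [spaceSiteReflect, crossSlice_translate, crossSlice_spaceReflect ρ hρu]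
  congr 1
  simp; ring

end Translate

end FiniteTemperature

end Literature.Barriers.QuantumFields

end
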